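import Summits.AtomisticToContinuum.Crystallization.Theorems.OverbindingBudgetAffineBarlowNorm

/-!
# OverbindingBudget — the site-energy series of a chart over a Hägg-coded Barlow stacking is summable; admissible identity charts; the admissibility constructor
# (decomp-a2c lens-4, generation 46; S support: discharges the summability clause of `ChartAdmissible` for Zr `CoreRegistration` and the P5 inhabitant)

Imports ONLY `…Theorems.OverbindingBudgetAffineBarlowNorm`; reference structures = Literature `barlowStacking 1 (√(2/3)) s` / `barlowPos` (review q15670697).
PROVED, 0 sorry:
* `abs_lennardJones_le_inv_pow_six` — `|V_LJ(ρ)| ≤ (c⁻¹¹²/12 + c⁻⁶/6)·x⁻⁶` for `0 < c`, `1 ≤ x`, `c x ≤ ρ`;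
* `barlowTriple`, `barlowStacking_eq_range`, `barlowTriple_injective` — the coordinate equivalence `ℤ³ ≃ barlowStacking 1 √(2/3) s` (injectivity from the
  Literature's uniform discreteness `le_dist_barlowPos`);
* `summable_inv_one_add_sq` (`∑_ℤ (1+n²)⁻¹ < ∞`), `sq_coord_le_norm_sq_barlowPos` (`(i²+j²+L²)/8 ≤ ‖p‖²`, via `|ℓ(L)| ≤ |L|`), `inv_norm_pow_six_le`
  (`‖p‖⁻⁶ ≤ 272³ (1+L²)⁻¹(1+i²)⁻¹(1+j²)⁻¹` for nonzero structure points);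
* `barlowEquiv` (+ `_apply`), `ljMajorant`, `summable_ljMajorant`, `abs_lennardJones_barlowTriple_le` — the separable ℤ³ MAJORANT `(c⁻¹¹²/12 + c⁻⁶/6)·272³·Π(1+·²)⁻¹`,
  `c = a₀(1 − m)`, INDEPENDENT of the Hägg sequence and of `B`, dominating the site-energy terms pointwise;
* ★ `summable_lennardJones_chart` — for a Hägg sequence `s`, `B` within `m ≤ 1/6` of a linear isometry and `a₀ > 0`, `p ↦ V_LJ(a₀‖B p‖)` is summable over
  `barlowStacking 1 √(2/3) s`; `neg_tsum_ljMajorant_le_tsum_weighted` — every `[0,1]`-weighted site-energy series is `≥ −∑ ljMajorant a₀ m` (uniform lower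
  bound; the Seam's `bddBelow_refTail_continues`);
* `chartAdmissible_id`, `chartAdmissible_id_hcp` — hence the identity chart of EVERY Hägg-coded stacking is admissible outright (`θ ≥ 0`; record `θ = 1/25`,
  hcp = `alternatingHagg`): a certified inhabitant of the admissibility class (NEAR charts; the FAR inhabitant of Z2's hypothesis class additionally needs a
  `PatternFar` frame — seat memo PLAN-g47-PatternFrameHcp);
* ★ `chartAdmissible_of_first_shell` — the ADMISSIBILITY CONSTRUCTOR: `⟨s, B, a₀, a₀‖B w₁‖⟩` is admissible once `w₁` minimises `‖B ·‖` over the first shell only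
  (`m ≤ min (3θ) (1/6)`) — what Zr and the far inhabitant call.
-/

namespace Summit.AtomisticToContinuum.Crystallization.Theorems.OverbindingBudgetAffineFarSmoothSplit

open scoped BigOperators Classical
open Literature.MathematicalPhysics.StatisticalMechanics

local notation "E3" => EuclideanSpace ℝ (Fin 3)

/-- Lennard-Jones tail bound: if `0 < c`, `1 ≤ x` and `c·x ≤ ρ` then `|V_LJ(ρ)| ≤ (c⁻¹¹²/12 + c⁻⁶/6) · x⁻⁶`. [this file] -/
theorem abs_lennardJones_le_inv_pow_six {c x ρ : ℝ} (hc : 0 < c) (hx : 1 ≤ x) (hρ : c * x ≤ ρ) :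
    |lennardJones ρ| ≤ (c⁻¹ ^ 12 / 12 + c⁻¹ ^ 6 / 6) * x⁻¹ ^ 6 := by
  have hx0 : 0 < x := by linarith
  have hcx : 0 < c * x := mul_pos hc hx0
  have hρ0 : 0 < ρ := lt_of_lt_of_le hcx hρ
  have hy : ρ⁻¹ ≤ c⁻¹ * x⁻¹ := by rw [← mul_inv]; exact inv_anti₀ hcx hρ
  have hy0 : 0 ≤ ρ⁻¹ := by positivity
  have hxi1 : x⁻¹ ≤ 1 := inv_le_one_of_one_le₀ hx
  have hxi0 : 0 ≤ x⁻¹ := by positivity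
  have hci0 : 0 ≤ c⁻¹ := by positivity
  have h6 : ρ⁻¹ ^ 6 ≤ c⁻¹ ^ 6 * x⁻¹ ^ 6 := by rw [← mul_pow]; exact pow_le_pow_left₀ hy0 hy 6
  have h12 : ρ⁻¹ ^ 12 ≤ c⁻¹ ^ 12 * x⁻¹ ^ 6 := by
    have h12' : ρ⁻¹ ^ 12 ≤ c⁻¹ ^ 12 * x⁻¹ ^ 12 := by rw [← mul_pow]; exact pow_le_pow_left₀ hy0 hy 12
    have hx12 : x⁻¹ ^ 12 ≤ x⁻¹ ^ 6 := pow_le_pow_of_le_one hxi0 hxi1 (by norm_num)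
    exact h12'.trans (mul_le_mul_of_nonneg_left hx12 (by positivity))
  have hV' : |lennardJones ρ| ≤ 1 / 12 * ρ⁻¹ ^ 12 + 1 / 6 * ρ⁻¹ ^ 6 := by
    unfold lennardJones
    refine (abs_sub _ _).trans ?_
    rw [abs_of_nonneg (by positivity), abs_of_nonneg (by positivity)]
  nlinarith

/-! ## Summability of the site-energy series of a chart over a Barlow reference structure -/

/-- The coordinate map `(L, i, j) ↦ barlowPos 1 √(2/3) s L i j` on `ℤ³`. -/
noncomputable def barlowTriple (s : ℤ → ℤ) (t : ℤ × ℤ × ℤ) : E3 := barlowPos 1 (Real.sqrt (2 / 3)) s t.1 t.2.1 t.2.2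

/-- The stacking is the range of the coordinate map. [this file] -/
theorem barlowStacking_eq_range (s : ℤ → ℤ) : barlowStacking 1 (Real.sqrt (2 / 3)) s = Set.range (barlowTriple s) := by
  ext p
  constructor
  · rintro ⟨L, a, b, rfl⟩; exact ⟨(L, a, b), rfl⟩
  · rintro ⟨⟨L, a, b⟩, rfl⟩; exact ⟨L, a, b, rfl⟩

/-- The coordinate map is injective (distinct index triples are `≥ min 1 √(2/3)` apart, Literature `le_dist_barlowPos`). [this file] -/
theorem barlowTriple_injective (s : ℤ → ℤ) : Function.Injective (barlowTriple s) := by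
  rintro ⟨L, a, b⟩ ⟨L', a', b'⟩ h
  by_contra hne
  have hd := le_dist_barlowPos 1 (Real.sqrt (2 / 3)) s zero_le_one (Real.sqrt_nonneg _) (k := L) (i := a) (j := b)
    (k' := L') (i' := a') (j' := b') (fun h' => hne (by simpa [Prod.ext_iff] using h'))
  have h0 : dist (barlowTriple s (L, a, b)) (barlowTriple s (L', a', b')) = 0 := by rw [h, dist_self]
  have hpos : 0 < min (1 : ℝ) (Real.sqrt (2 / 3)) := lt_min one_pos (Real.sqrt_pos.mpr (by norm_num))
  simp only [barlowTriple] at h0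
  linarith

/-- `∑_{n ∈ ℤ} (1 + n²)⁻¹ < ∞`. [this file] -/
private theorem summable_inv_one_add_sq : Summable fun n : ℤ => (1 + (n : ℝ) ^ 2)⁻¹ := by
  have h2 : Summable fun n : ℤ => 1 / (n : ℝ) ^ 2 := Real.summable_one_div_int_pow.mpr (by norm_num)
  have h0 : Summable fun n : ℤ => if n = 0 then (1 : ℝ) else 0 := by
    refine summable_of_ne_finset_zero (s := {0}) fun n hn => ?_
    rw [Finset.mem_singleton] at hn; simp [hn]
  refine Summable.of_nonneg_of_le (fun n => by positivity) (fun n => ?_) (h2.add h0)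
  rcases eq_or_ne n 0 with rfl | hn
  · simp
  · have hn2 : (0 : ℝ) < (n : ℝ) ^ 2 := by positivity
    simp only [hn, if_false, add_zero, one_div]
    exact inv_anti₀ hn2 (by linarith)

/-- Coordinate comparison: `(i² + j² + L²)/8 ≤ ‖barlowPos 1 √(2/3) s L i j‖²` for a Hägg sequence (`|ℓ| ≤ |L|`; `3‖p‖² − 3(i²+j²+L²)/8 ≥ (3/2)(i+j+ℓ)² +
(9/8)(i²+j²+ℓ²) ≥ 0` after `2L² ≥ … + (13/8)ℓ²`). [this file] -/
theorem sq_coord_le_norm_sq_barlowPos {s : ℤ → ℤ} (hs : IsHaggSeq s) (L i j : ℤ) :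
    ((i : ℝ) ^ 2 + (j : ℝ) ^ 2 + (L : ℝ) ^ 2) / 8 ≤ ‖barlowPos 1 (Real.sqrt (2 / 3)) s L i j‖ ^ 2 := by
  have hsq := three_mul_norm_sq_barlowPos s L i j
  have hℓ : (haggLabel s L : ℝ) ^ 2 ≤ (L : ℝ) ^ 2 := by
    have h : |haggLabel s L| ≤ |L| := by
      -- inlined (the Norm lemma `abs_haggLabel_le` is private there: its statement is already in the tree elsewhere)
      have hw : ∀ (m : ℤ) (n : ℕ), |haggWindow s m n| ≤ n := by
        intro m n
        unfold haggWindow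
        refine (Finset.abs_sum_le_sum_abs _ _).trans ?_
        have : ∀ i ∈ Finset.range n, |s (m + i)| = 1 := by
          intro i _
          rcases hs (m + i) with h | h <;> simp [h]
        rw [Finset.sum_congr rfl this]
        simp
      rcases le_or_gt 0 L with hL | hL
      · lift L to ℕ using hL
        rw [haggLabel_natCast, Nat.abs_cast]
        exact hw 0 L
      · obtain ⟨n, rfl⟩ : ∃ n : ℕ, L = -(n : ℤ) := ⟨(-L).toNat, by omega⟩
        rw [haggLabel_neg_natCast, abs_neg, abs_neg, Nat.abs_cast]
        exact hw _ n
    have h' : ((|haggLabel s L| : ℤ) : ℝ) ≤ ((|L| : ℤ) : ℝ) := by exact_mod_cast h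
    push_cast at h'
    nlinarith [abs_nonneg (haggLabel s L : ℝ), sq_abs (haggLabel s L : ℝ), sq_abs (L : ℝ)]
  simp only [threeNormSq] at hsq
  push_cast at hsq
  nlinarith [sq_nonneg ((i : ℝ) + j + haggLabel s L), sq_nonneg (i : ℝ), sq_nonneg (j : ℝ), sq_nonneg (haggLabel s L : ℝ)]

/-- Inverse sixth power of a nonzero structure point against the separable majorant `272³ (1+L²)⁻¹ (1+i²)⁻¹ (1+j²)⁻¹`. [this file] -/
theorem inv_norm_pow_six_le {s : ℤ → ℤ} (hs : IsHaggSeq s) (L a b : ℤ) (h0 : barlowPos 1 (Real.sqrt (2 / 3)) s L a b ≠ 0) :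
    ‖barlowPos 1 (Real.sqrt (2 / 3)) s L a b‖⁻¹ ^ 6 ≤ 272 ^ 3 * ((1 + (L : ℝ) ^ 2)⁻¹ * ((1 + (a : ℝ) ^ 2)⁻¹ * (1 + (b : ℝ) ^ 2)⁻¹)) := by
  have hx1 : 1 ≤ ‖barlowPos 1 (Real.sqrt (2 / 3)) s L a b‖ := one_le_norm_of_mem_barlowStacking hs (barlowPos_mem L a b) h0
  have hS := sq_coord_le_norm_sq_barlowPos hs L a b
  -- name the quantities
  obtain ⟨x, hx⟩ : ∃ x : ℝ, ‖barlowPos 1 (Real.sqrt (2 / 3)) s L a b‖ = x := ⟨_, rfl⟩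
  rw [hx] at hx1 hS ⊢
  obtain ⟨S, hSdef⟩ : ∃ S : ℝ, (a : ℝ) ^ 2 + (b : ℝ) ^ 2 + (L : ℝ) ^ 2 = S := ⟨_, rfl⟩
  obtain ⟨P, hPdef⟩ : ∃ P : ℝ, (1 + (L : ℝ) ^ 2) * ((1 + (a : ℝ) ^ 2) * (1 + (b : ℝ) ^ 2)) = P := ⟨_, rfl⟩
  have ha2 : (0:ℝ) ≤ (a : ℝ) ^ 2 := sq_nonneg _
  have hb2 : (0:ℝ) ≤ (b : ℝ) ^ 2 := sq_nonneg _
  have hL2 : (0:ℝ) ≤ (L : ℝ) ^ 2 := sq_nonneg _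
  have hS0 : 0 ≤ S := by rw [← hSdef]; positivity
  have hP0 : 0 < P := by rw [← hPdef]; positivity
  have hS' : S / 8 ≤ x ^ 2 := by rw [← hSdef]; linarith
  have hx2 : (1 + S) / 272 ≤ x ^ 2 := by nlinarith
  -- P ≤ (1 + S)³
  have hP : P ≤ (1 + S) ^ 3 := by
    rw [← hPdef, ← hSdef]
    have e1 : 1 + (L : ℝ) ^ 2 ≤ 1 + ((a : ℝ) ^ 2 + (b : ℝ) ^ 2 + (L : ℝ) ^ 2) := by linarith
    have e2 : 1 + (a : ℝ) ^ 2 ≤ 1 + ((a : ℝ) ^ 2 + (b : ℝ) ^ 2 + (L : ℝ) ^ 2) := by linarith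
    have e3 : 1 + (b : ℝ) ^ 2 ≤ 1 + ((a : ℝ) ^ 2 + (b : ℝ) ^ 2 + (L : ℝ) ^ 2) := by linarith
    calc (1 + (L : ℝ) ^ 2) * ((1 + (a : ℝ) ^ 2) * (1 + (b : ℝ) ^ 2))
        ≤ (1 + ((a : ℝ) ^ 2 + (b : ℝ) ^ 2 + (L : ℝ) ^ 2)) * ((1 + ((a : ℝ) ^ 2 + (b : ℝ) ^ 2 + (L : ℝ) ^ 2))
            * (1 + ((a : ℝ) ^ 2 + (b : ℝ) ^ 2 + (L : ℝ) ^ 2))) :=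
          mul_le_mul e1 (mul_le_mul e2 e3 (by positivity) (by positivity)) (by positivity) (by positivity)
      _ = _ := by ring
  -- x⁶ ≥ P / 272³
  have hx6 : P / 272 ^ 3 ≤ x ^ 6 := by
    have h3 : ((1 + S) / 272) ^ 3 ≤ (x ^ 2) ^ 3 := pow_le_pow_left₀ (by positivity) hx2 3
    have h4 : P / 272 ^ 3 ≤ ((1 + S) / 272) ^ 3 := by
      rw [div_pow]; exact div_le_div_of_nonneg_right hP (by positivity)
    calc P / 272 ^ 3 ≤ ((1 + S) / 272) ^ 3 := h4
      _ ≤ (x ^ 2) ^ 3 := h3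
      _ = x ^ 6 := by ring
  have hPi : 0 < P / 272 ^ 3 := by positivity
  calc x⁻¹ ^ 6 = (x ^ 6)⁻¹ := by rw [inv_pow]
    _ ≤ (P / 272 ^ 3)⁻¹ := inv_anti₀ hPi hx6
    _ = 272 ^ 3 * P⁻¹ := by rw [inv_div, div_eq_mul_inv]
    _ = _ := by rw [← hPdef, mul_inv, mul_inv]

/-- The coordinate equivalence `ℤ³ ≃ barlowStacking 1 √(2/3) s` (a lemma device: reparametrisation of the Literature set, no new concept). -/
noncomputable def barlowEquiv (s : ℤ → ℤ) : ℤ × ℤ × ℤ ≃ ↥(barlowStacking 1 (Real.sqrt (2 / 3)) s) :=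
  (Equiv.ofInjective _ (barlowTriple_injective s)).trans (Equiv.setCongr (barlowStacking_eq_range s).symm)

/-- The equivalence is the coordinate map. [this file] -/
theorem barlowEquiv_apply (s : ℤ → ℤ) (t : ℤ × ℤ × ℤ) :
    ((barlowEquiv s t : ↥(barlowStacking 1 (Real.sqrt (2 / 3)) s)) : E3) = barlowTriple s t := rfl

/-- The separable `ℤ³` MAJORANT of the site-energy terms of a chart with scale `a₀` and distortion `m`:
`(c⁻¹¹²/12 + c⁻⁶/6) · 272³ · (1+L²)⁻¹ (1+i²)⁻¹ (1+j²)⁻¹`, `c = a₀ (1 − m)` — independent of the Hägg sequence and of the linear part. -/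
noncomputable def ljMajorant (a₀ m : ℝ) (t : ℤ × ℤ × ℤ) : ℝ :=
  ((a₀ * (1 - m))⁻¹ ^ 12 / 12 + (a₀ * (1 - m))⁻¹ ^ 6 / 6) *
    (272 ^ 3 * ((1 + (t.1 : ℝ) ^ 2)⁻¹ * ((1 + (t.2.1 : ℝ) ^ 2)⁻¹ * (1 + (t.2.2 : ℝ) ^ 2)⁻¹)))

/-- The majorant is summable over `ℤ³`. [this file] -/
theorem summable_ljMajorant (a₀ m : ℝ) : Summable (ljMajorant a₀ m) := by
  have hus : Summable fun n : ℤ => (1 + (n : ℝ) ^ 2)⁻¹ := summable_inv_one_add_sq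
  have hu0 : ∀ n : ℤ, 0 ≤ (1 + (n : ℝ) ^ 2)⁻¹ := fun n => by positivity
  have h3 : Summable fun t : ℤ × ℤ × ℤ => (1 + (t.1 : ℝ) ^ 2)⁻¹ * ((1 + (t.2.1 : ℝ) ^ 2)⁻¹ * (1 + (t.2.2 : ℝ) ^ 2)⁻¹) :=
    hus.mul_of_nonneg (hus.mul_of_nonneg hus hu0 hu0) hu0 fun t => mul_nonneg (hu0 _) (hu0 _)
  exact (h3.mul_left (272 ^ 3)).mul_left _

/-- **Pointwise domination**: for a Hägg sequence `s`, `B` within `m ≤ 1/6` of a linear isometry and `a₀ > 0`, the site-energy term at the structure point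
with index `t` is bounded by the majorant at `t` (the `r⁻⁶` tail on a `1`-separated structure; `V(0) = 0` at the centre by the junk value `0⁻¹ = 0`). [this file] -/
theorem abs_lennardJones_barlowTriple_le {s : ℤ → ℤ} (hs : IsHaggSeq s) {B : E3 →ₗ[ℝ] E3} {m : ℝ} (hm : m ≤ 1 / 6)
    (hB : ∃ Q : E3 →ₗᵢ[ℝ] E3, ∀ v, ‖B v - Q v‖ ≤ m * ‖v‖) {a₀ : ℝ} (ha : 0 < a₀) (t : ℤ × ℤ × ℤ) :
    |lennardJones (a₀ * ‖B (barlowTriple s t)‖)| ≤ ljMajorant a₀ m t := by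
  obtain ⟨Q, hQ⟩ := hB
  obtain ⟨L, a, b⟩ := t
  have hc0 : 0 < a₀ * (1 - m) := by nlinarith
  have hK0 : 0 ≤ (a₀ * (1 - m))⁻¹ ^ 12 / 12 + (a₀ * (1 - m))⁻¹ ^ 6 / 6 := by positivity
  simp only [barlowTriple, ljMajorant]
  by_cases h0 : barlowPos 1 (Real.sqrt (2 / 3)) s L a b = 0
  · rw [h0, map_zero, norm_zero, mul_zero]
    have : |lennardJones 0| = 0 := by simp [lennardJones]
    rw [this]
    exact mul_nonneg hK0 (by positivity)
  have hx1 : 1 ≤ ‖barlowPos 1 (Real.sqrt (2 / 3)) s L a b‖ := one_le_norm_of_mem_barlowStacking hs (barlowPos_mem L a b) h0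
  have hlow : (1 - m) * ‖barlowPos 1 (Real.sqrt (2 / 3)) s L a b‖ ≤ ‖B (barlowPos 1 (Real.sqrt (2 / 3)) s L a b)‖ := by
    have := norm_sub_norm_le (Q (barlowPos 1 (Real.sqrt (2 / 3)) s L a b)) (Q (barlowPos 1 (Real.sqrt (2 / 3)) s L a b) -
      B (barlowPos 1 (Real.sqrt (2 / 3)) s L a b))
    rw [sub_sub_cancel, Q.norm_map] at this
    have h' : ‖Q (barlowPos 1 (Real.sqrt (2 / 3)) s L a b) - B (barlowPos 1 (Real.sqrt (2 / 3)) s L a b)‖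
        ≤ m * ‖barlowPos 1 (Real.sqrt (2 / 3)) s L a b‖ := by rw [norm_sub_rev]; exact hQ _
    nlinarith
  have hρ : a₀ * (1 - m) * ‖barlowPos 1 (Real.sqrt (2 / 3)) s L a b‖ ≤ a₀ * ‖B (barlowPos 1 (Real.sqrt (2 / 3)) s L a b)‖ := by
    nlinarith
  exact (abs_lennardJones_le_inv_pow_six hc0 hx1 hρ).trans (mul_le_mul_of_nonneg_left (inv_norm_pow_six_le hs L a b h0) hK0)

/-- **The site-energy series of a chart is summable**: for a Hägg sequence `s`, a linear map `B` within `m ≤ 1/6` of a linear isometry and a scale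
`a₀ > 0`, `p ↦ V_LJ(a₀‖B p‖)` is (absolutely) summable over `barlowStacking 1 √(2/3) s` — by comparison with `ljMajorant` through `barlowEquiv`.  This discharges
the summability clause of `ChartAdmissible` for every chart that Zr or the inhabitant construction produces. [this file] -/
theorem summable_lennardJones_chart {s : ℤ → ℤ} (hs : IsHaggSeq s) {B : E3 →ₗ[ℝ] E3} {m : ℝ} (hm : m ≤ 1 / 6)
    (hB : ∃ Q : E3 →ₗᵢ[ℝ] E3, ∀ v, ‖B v - Q v‖ ≤ m * ‖v‖) {a₀ : ℝ} (ha : 0 < a₀) :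
    Summable fun p : ↥(barlowStacking 1 (Real.sqrt (2 / 3)) s) => lennardJones (a₀ * ‖B (p : E3)‖) := by
  rw [← (barlowEquiv s).summable_iff]
  refine Summable.of_norm_bounded (summable_ljMajorant a₀ m) fun t => ?_
  rw [Function.comp_apply, barlowEquiv_apply, Real.norm_eq_abs]
  exact abs_lennardJones_barlowTriple_le hs hm hB ha t

/-- **Uniform lower bound for weighted site-energy series**: with weights `w ∈ [0, 1]` (e.g. the smooth tail weight), the weighted series over the stacking is
`≥ −∑ ljMajorant a₀ m` — a bound INDEPENDENT of the Hägg sequence (used by the Seam: `refTail` is bounded below on every continuation class, so `tailInf` is a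
genuine infimum). [this file] -/
theorem neg_tsum_ljMajorant_le_tsum_weighted {s : ℤ → ℤ} (hs : IsHaggSeq s) {B : E3 →ₗ[ℝ] E3} {m : ℝ} (hm : m ≤ 1 / 6)
    (hB : ∃ Q : E3 →ₗᵢ[ℝ] E3, ∀ v, ‖B v - Q v‖ ≤ m * ‖v‖) {a₀ : ℝ} (ha : 0 < a₀) {w : E3 → ℝ} (hw0 : ∀ p, 0 ≤ w p)
    (hw1 : ∀ p, w p ≤ 1) :
    -(∑' t : ℤ × ℤ × ℤ, ljMajorant a₀ m t) ≤
      ∑' p : ↥(barlowStacking 1 (Real.sqrt (2 / 3)) s), w (p : E3) * lennardJones (a₀ * ‖B (p : E3)‖) := by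
  have hV := summable_lennardJones_chart hs hm hB ha
  have hW : Summable fun p : ↥(barlowStacking 1 (Real.sqrt (2 / 3)) s) => w (p : E3) * lennardJones (a₀ * ‖B (p : E3)‖) :=
    Summable.of_norm_bounded hV.abs fun p => by
      rw [Real.norm_eq_abs, abs_mul]
      exact mul_le_of_le_one_left (abs_nonneg _) (abs_le.mpr ⟨by linarith [hw0 (p : E3)], hw1 _⟩)
  -- pull back along the equivalence and compare termwise with the majorant
  have hWe := ((barlowEquiv s).summable_iff).mpr hW
  have hle : ∀ t : ℤ × ℤ × ℤ, -ljMajorant a₀ m t ≤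
      (fun p : ↥(barlowStacking 1 (Real.sqrt (2 / 3)) s) => w (p : E3) * lennardJones (a₀ * ‖B (p : E3)‖)) (barlowEquiv s t) := by
    intro t
    have h1 := abs_lennardJones_barlowTriple_le hs hm hB ha t
    simp only [barlowEquiv_apply]
    have h2 : |w (barlowTriple s t) * lennardJones (a₀ * ‖B (barlowTriple s t)‖)| ≤ ljMajorant a₀ m t := by
      rw [abs_mul]
      exact (mul_le_of_le_one_left (abs_nonneg _) (abs_le.mpr ⟨by linarith [hw0 (barlowTriple s t)], hw1 _⟩)).trans h1
    linarith [neg_abs_le (w (barlowTriple s t) * lennardJones (a₀ * ‖B (barlowTriple s t)‖))]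
  calc -(∑' t : ℤ × ℤ × ℤ, ljMajorant a₀ m t) = ∑' t : ℤ × ℤ × ℤ, -ljMajorant a₀ m t := by rw [tsum_neg]
    _ ≤ ∑' t : ℤ × ℤ × ℤ, (fun p : ↥(barlowStacking 1 (Real.sqrt (2 / 3)) s) =>
          w (p : E3) * lennardJones (a₀ * ‖B (p : E3)‖)) (barlowEquiv s t) :=
        ((summable_ljMajorant a₀ m).neg).tsum_le_tsum hle hWe
    _ = _ := (barlowEquiv s).tsum_eq (fun p : ↥(barlowStacking 1 (Real.sqrt (2 / 3)) s) =>
          w (p : E3) * lennardJones (a₀ * ‖B (p : E3)‖))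

/-- **The identity chart of every Hägg-coded stacking is admissible** (no hypothesis left): `ChartAdmissible θ ⟨s, id, 1, 1⟩` for `θ ≥ 0` — a
Lean-certified inhabitant of the admissibility class (the NEAR charts; the FAR inhabitant of Z2's hypothesis class additionally needs a
`PatternFar` frame, see the seat memo PLAN-g47-PatternFrameHcp). [this file] -/
theorem chartAdmissible_id {θ : ℝ} (hθ : 0 ≤ θ) {s : ℤ → ℤ} (hs : IsHaggSeq s) :
    ChartAdmissible θ ⟨s, LinearMap.id, 1, 1⟩ := by
  refine chartAdmissible_id_of_summable hθ hs ?_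
  have hB : ∃ Q : E3 →ₗᵢ[ℝ] E3, ∀ v, ‖(LinearMap.id : E3 →ₗ[ℝ] E3) v - Q v‖ ≤ (0 : ℝ) * ‖v‖ :=
    ⟨LinearIsometry.id, fun v => by simp⟩
  exact summable_lennardJones_chart hs (by norm_num) hB one_pos

/-- In particular for the hcp stacking (`alternatingHagg`, labels `0,1,0,1,…`) at the record `θ = 1/25`. [this file] -/
theorem chartAdmissible_id_hcp : ChartAdmissible (1 / 25) ⟨alternatingHagg, LinearMap.id, 1, 1⟩ :=
  chartAdmissible_id (by norm_num) isHaggSeq_alternating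

/-- **Admissibility constructor** (what Zr `CoreRegistration` and the far inhabitant call): for a Hägg sequence `s`, a linear map `B` within
`m ≤ min (3θ) (1/6)` of a linear isometry, a scale `a₀ > 0` and a first-shell point `w₁` minimising `‖B ·‖` over the FIRST SHELL only, the chart
`⟨s, B, a₀, a₀‖B w₁‖⟩` is admissible — the `nn`-clauses hold on the whole (infinite) reference structure by `norm_map_first_shell_le`, and the
site-energy series is summable by `summable_lennardJones_chart`. [this file] -/
theorem chartAdmissible_of_first_shell {θ m : ℝ} (hθ : m ≤ 3 * θ) (hm : m ≤ 1 / 6) {s : ℤ → ℤ} (hs : IsHaggSeq s)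
    {B : E3 →ₗ[ℝ] E3} (hB : ∃ Q : E3 →ₗᵢ[ℝ] E3, ∀ v, ‖B v - Q v‖ ≤ m * ‖v‖) {a₀ : ℝ} (ha : 0 < a₀) {w₁ : E3}
    (hw₁ : w₁ ∈ barlowStacking 1 (Real.sqrt (2 / 3)) s) (h₁ : ‖w₁‖ = 1)
    (hmin : ∀ p ∈ barlowStacking 1 (Real.sqrt (2 / 3)) s, ‖p‖ = 1 → ‖B w₁‖ ≤ ‖B p‖) :
    ChartAdmissible θ ⟨s, B, a₀, a₀ * ‖B w₁‖⟩ := by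
  obtain ⟨Q, hQ⟩ := hB
  -- `B w₁ ≠ 0`: `‖B w₁‖ ≥ 1 - m > 0`
  have hBw : 1 - m ≤ ‖B w₁‖ := by
    have := norm_sub_norm_le (Q w₁) (Q w₁ - B w₁)
    rw [sub_sub_cancel, Q.norm_map, h₁] at this
    have h' : ‖Q w₁ - B w₁‖ ≤ m * ‖w₁‖ := by rw [norm_sub_rev]; exact hQ w₁
    rw [h₁, mul_one] at h'
    linarith
  have hnn : 0 < a₀ * ‖B w₁‖ := mul_pos ha (by linarith)
  refine ⟨hs, ha, hnn, ⟨Q, fun v => (hQ v).trans ?_⟩, fun p hp hp0 => ?_, ⟨w₁, hw₁, ?_, rfl⟩,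
    summable_lennardJones_chart hs hm ⟨Q, hQ⟩ ha⟩
  · exact mul_le_mul_of_nonneg_right hθ (norm_nonneg v)
  · -- the `nn`-inequality on the whole structure
    refine mul_le_mul_of_nonneg_left ?_ ha.le
    rcases eq_or_ne ‖p‖ 1 with hp1 | hp1
    · exact hmin p hp hp1
    · exact norm_map_first_shell_le hs hm ⟨Q, hQ⟩ h₁ hp hp0 hp1
  · intro h; rw [h, norm_zero] at h₁; exact zero_ne_one h₁

end Summit.AtomisticToContinuum.Crystallization.Theorems.OverbindingBudgetAffineFarSmoothSplit
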